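import Summits.QuantumFields.BalabanUV.Beta.D1BFx.PackedWardLettersFirst
import Summits.QuantumFields.BalabanUV.Beta.D1BFx.ColourLiftAdE3

/-!
# `BalabanUV.Beta.D1BFx.PackedWardLettersSecond` — road «BF-x» for binder row D1, slot (K), chain step (I) «(A1)-PACKED», brick (B3) PART 2b
# «A1-PACKED-TORUS — THE MIXED WARD LETTERS AT THE TORUS RESPONSES» (`A1-PACKED-SPEC.md` v0.4 §9; ruling ρ-g16-1′ «AD-E3 LIFT»): **ON EVERY COARSE TORUS
# THE MIXED ONE-SIDED WARD-L LETTERS `aₛₜ bₛₜ` OF `KCombineCovColourTorus.identity_array_currency_cov_What0_stripped` HOLD FOR THE EVEN RESPONSE-PACKED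
# TUPLE** — leaf-03's `ColourLiftAdE3.ward₂_even_adE3` (the `ad e₃` lift: no odd part, no `R`) with its two SOURCE hypotheses `hs₂ ht₂` DISCHARGED for the
# packed columns of `M_T⁻¹` (PART 2a's `WardJetsCombSources.field_rows_packed_col` + «generator tables have no multiplier rows»); the LIFTED per-bond
# letters [P1′]∕[P2′] stay DISPLAYED.

HONEST DEPENDENCY (cell records, verbatim): «continuum YM on T⁴ ⇐ BetaPertH ∧ nine spine estimates (0/9 proved); BetaPertH ⇐ (D1) ∧ (D4) ∧
CAP+tail; G-an2-4 gates asym, D1 and NE2/3/4.»  HONEST FRAMING (cell contract, verbatim): «discharging `BetaPertH` makes Bałaban's UV stability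
UNCONDITIONAL — a real constructive-QFT result; it is NOT the continuum limit and NOT the Clay problem.»  THIS MODULE DISCHARGES NOTHING of (K),
of D1 or of the wall: [folklore] composition BY NAME of `ColourLiftAdE3.ward₂_even_adE3`, `ColourVectorLift.one_kronecker_mulVec_tensor`,
`WardJetsCombSources.field_rows_packed_col` (via PART 2a) + one finite-sum vanishing lemma.  The colour model `c₃ = ad e₃` is the road's MODEL decision
(ρ-g16-1′); [P1′]∕[P2′] are DISPLAYED.  No definition, no `def … : Prop`, nothing cited, 0 sorry.  0 root-level binders of row D1 discharged; (K) NOT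
closed; NOT D1, NOT `BetaPertH`, NOT continuum, NOT Clay.

ABSOLUTE RULE (cell charter, verbatim): «No internally-minted statement may enter as a cited fact. Every hypothesis is either kernel-proved in this
package or a verbatim quotation of a PUBLISHED theorem with page reference. The manuscript(s) under audit are NOT citable for their own disputed
steps — they are the thing under adjudication; programme-internal (2001/route/tribunal) claims are never citable.»

CONTENT (torus `n p`, `hr : r ∈ box (d+1) n`; sources `bₛ bₜ : J ⊕ CombRows`; packed responses `rₛ k := M_T⁻¹ (Sum.map id inl k) (inr bₛ)`, `rₜ`).
* §1 `oslot_kronecker_fromRows_zero_eq_zero` (a lifted generator family WITHOUT multiplier rows has zero other-slot reading against any weight vanishing on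
  the field components), **`lifted_source_eq_zero`** (the weight `(1 ⊗ kkt K̂ Q̂)·(e₃ ⊗ r_b)` does, by `field_rows_packed_col`).
* §2 **`packed_ward₂`** — `aₛₜ ∧ bₛₜ` for the even packed tuple `kₛₜ := Σ_{k,l} rₛ k·rₜ l • K₂ k l`, `kₛ := Σ rₛ•K₁`, `wₜ := Σ rₜ•x₁`, `wₛₜ := Σ rₛrₜ•x₂`, …, from the
  DISPLAYED lifted letters [P1′] [P2′] (any colour family `C` with `C 2 = c₃`).  **`packed_ward₂_field`** — the same with tables vanishing at the coarse-multiplier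
  indices: `I d n p`-sums with the responses of (B4b) ∕ PART 1, i.e. the letters `aₛₜ bₛₜ` of the stripped identity VERBATIM.
Unit `b2b-balaban-beta-d1-p2` (road owner, gen 17), 2026-08-22.
-/

noncomputable section

namespace Summit.QuantumFields.BalabanUV.Beta.D1BFx.PackedWardLettersSecond

open Matrix
open scoped BigOperators Kronecker
open Literature.Probability.LatticeModels (TorusSite)
open Literature.MathematicalPhysics.QuantumFieldTheory.Balaban1983to89
open Literature.MathematicalPhysics.QuantumFieldTheory.Balaban1983to89.Beta
open Literature.MathematicalPhysics.QuantumFieldTheory.Balaban1983to89.Beta.Composition (kkt)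
open AffineAveraging (box toSite)
open Summit.QuantumFields.BalabanUV.Beta.D1BFx.TorusCombKKT (I J CombRows tauT Khat Qhat isUnit_det_MT)
open Summit.QuantumFields.BalabanUV.Beta.D1BFx.TorusGaugeBasis (What0 tauT_mul_What0 Khat_mul_What0 Qhat_mul_What0)
open Summit.QuantumFields.BalabanUV.Beta.D1BFx.TorusGaugeBasisTranspose (Khat_transpose_mul_What0)
open Summit.QuantumFields.BalabanUV.Beta.D1BFx.WardJetsFromNoether (oslot oslot_apply)
open Summit.QuantumFields.BalabanUV.Beta.D1BFx.WardJetsCombSources (field_rows_packed_col)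
open Summit.QuantumFields.BalabanUV.Beta.D1BFx.ColourVectorLift (one_kronecker_mulVec_tensor)
open Summit.QuantumFields.BalabanUV.Beta.D1BFx.ColourLiftAdE3 (c₃ e₃ ward₂_even_adE3)
open Summit.QuantumFields.BalabanUV.Beta.D1BFx.PackedWardLettersFirst (MT_mul_inv)

/-! ## §1 The lifted second-order source conditions vanish for the packed columns of `M_T⁻¹` -/

section Source

variable {l ν μ ρ : Type*} [Fintype l] [Fintype ν] [Fintype μ]

/-- [folklore] A lifted generator family WITHOUT MULTIPLIER ROWS (`B q′ ⊗ fromRows (Y q′) 0`) has zero other-slot reading against every weight vanishing on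
the FIELD components. -/
theorem oslot_kronecker_fromRows_zero_eq_zero (B : l × (ν ⊕ μ) → Matrix l l ℝ) (Y : l × (ν ⊕ μ) → Matrix ν ρ ℝ)
    (w : l × (ν ⊕ μ) → ℝ) (hw : ∀ γ (i : ν), w (γ, Sum.inl i) = 0) :
    oslot (fun q' : l × (ν ⊕ μ) => B q' ⊗ₖ Matrix.fromRows (Y q') (0 : Matrix μ ρ ℝ)) w = 0 := by
  ext j a
  simp only [oslot_apply, Matrix.zero_apply, Fintype.sum_prod_type, Fintype.sum_sum_type, Matrix.kroneckerMap_apply, hw, zero_mul,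
    Finset.sum_const_zero, zero_add, Matrix.fromRows_apply_inr, Matrix.zero_apply, mul_zero]

variable [DecidableEq l]

/-- [folklore] … in particular against `(1 ⊗ 𝕄₀)·(θ ⊗ r)` whenever the FIELD rows of `𝕄₀·r` vanish (`one_kronecker_mulVec_tensor`). -/
theorem oslot_lift_eq_zero_of_field_rows (B : l × (ν ⊕ μ) → Matrix l l ℝ) (Y : l × (ν ⊕ μ) → Matrix ν ρ ℝ) (M₀ : Matrix (ν ⊕ μ) (ν ⊕ μ) ℝ)
    (θ : l → ℝ) (rr : ν ⊕ μ → ℝ) (hsrc : ∀ i : ν, (M₀ *ᵥ rr) (Sum.inl i) = 0) :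
    oslot (fun q' : l × (ν ⊕ μ) => B q' ⊗ₖ Matrix.fromRows (Y q') (0 : Matrix μ ρ ℝ))
      (((1 : Matrix l l ℝ) ⊗ₖ M₀) *ᵥ fun p : l × (ν ⊕ μ) => θ p.1 * rr p.2) = 0 := by
  rw [one_kronecker_mulVec_tensor]
  exact oslot_kronecker_fromRows_zero_eq_zero B Y _ fun γ i => by simp only [hsrc i, mul_zero]

end Source

/-! ## §2 The packed mixed Ward letters on the torus -/

section Torus

variable {d : ℕ} {n : ℕ} [NeZero n] {r : Fin (d + 1) → ℕ} (hr : r ∈ box (d + 1) n) (p : ℕ) [NeZero p]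
include hr

/-- [folklore] **THE LIFTED SECOND-ORDER SOURCE OF A TORUS RESPONSE VANISHES**: for the packed column `r_b k := M_T⁻¹ (Sum.map id inl k) (inr b)` of the torus
comb-gauged KKT inverse at any non-field source `b`, and any lifted generator family without multiplier rows,
`oslot (q′ ↦ B q′ ⊗ fromRows (Y q′) 0) ((1 ⊗ kkt K̂ Q̂)·(θ ⊗ r_b)) = 0` (the FIELD rows of `kkt K̂ Q̂·r_b` vanish: PART 2a ∕ `field_rows_packed_col`). -/
theorem lifted_source_eq_zero {l : Type*} [Fintype l] [DecidableEq l] (B : l × (I d n p ⊕ J d p) → Matrix l l ℝ)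
    (Y : l × (I d n p ⊕ J d p) → Matrix (I d n p) (CombRows (toSite r) n p) ℝ) (θ : l → ℝ) (b : J d p ⊕ CombRows (toSite r) n p) :
    oslot (fun q' : l × (I d n p ⊕ J d p) => B q' ⊗ₖ Matrix.fromRows (Y q') (0 : Matrix (J d p) (CombRows (toSite r) n p) ℝ))
      (((1 : Matrix l l ℝ) ⊗ₖ kkt (Khat (d := d) n p) (Qhat (d := d) n p)) *ᵥ fun q : l × (I d n p ⊕ J d p) =>
        θ q.1 * (kkt (Khat (d := d) n p) (Matrix.fromRows (Qhat (d := d) n p) (tauT (toSite r) n p)))⁻¹ (Sum.map id Sum.inl q.2) (Sum.inr b)) = 0 :=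
  oslot_lift_eq_zero_of_field_rows B Y (kkt (Khat (d := d) n p) (Qhat (d := d) n p)) θ
    (fun k => (kkt (Khat (d := d) n p) (Matrix.fromRows (Qhat (d := d) n p) (tauT (toSite r) n p)))⁻¹ (Sum.map id Sum.inl k) (Sum.inr b))
    (field_rows_packed_col (Khat (d := d) n p) (Qhat (d := d) n p) (tauT (toSite r) n p) (What0 r n p) (Khat_transpose_mul_What0 r n p hr)
      (Qhat_mul_What0 r n p hr) (by rw [tauT_mul_What0 r n p, Matrix.det_one]; exact isUnit_one) _ (MT_mul_inv hr p) b).2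

/-- [folklore] **(B3) PART 2b — THE PACKED MIXED WARD LETTERS `aₛₜ ∧ bₛₜ` OF THE EVEN TUPLE.**  For per-bond first and second data `K₁ Q₁ x₁`, `K₂ Q₂ x₂` on
`I ⊕ J`, ANY colour family `C` with `C 2 = c₃` (the `ad e₃` model, ρ-g16-1′), the DISPLAYED LIFTED letters [P1′] (every direction) and [P2′] (every pair), and
ANY two non-field sources `bₛ bₜ` with packed responses `rₛ rₜ` (columns of `M_T⁻¹`):
`kₛₜ·Ŵ₀ + kₛ·wₜ + kₜ·wₛ + K̂·wₛₜ = 0 ∧ qₛₜ·Ŵ₀ + qₛ·wₜ + qₜ·wₛ + Q̂·wₛₜ = 0` for the EVEN packed tuple `kₛₜ := Σ_{k,l} rₛ k·rₜ l • K₂ k l`, `kₛ := Σ_k rₛ k • K₁ k`,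
`wₜ := Σ rₜ•x₁`, `wₛₜ := Σ rₛrₜ•x₂`, … — the sources `hs₂ ht₂` of `ward₂_even_adE3` DISCHARGED by `lifted_source_eq_zero`. -/
theorem packed_ward₂ (C : Fin 3 → Matrix (Fin 3) (Fin 3) ℝ) (hC : C 2 = c₃)
    (K₁ : I d n p ⊕ J d p → Matrix (I d n p) (I d n p) ℝ) (Q₁ : I d n p ⊕ J d p → Matrix (J d p) (I d n p) ℝ)
    (K₂ : I d n p ⊕ J d p → I d n p ⊕ J d p → Matrix (I d n p) (I d n p) ℝ) (Q₂ : I d n p ⊕ J d p → I d n p ⊕ J d p → Matrix (J d p) (I d n p) ℝ)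
    (x₁ : I d n p ⊕ J d p → Matrix (I d n p) (CombRows (toSite r) n p) ℝ)
    (x₂ : I d n p ⊕ J d p → I d n p ⊕ J d p → Matrix (I d n p) (CombRows (toSite r) n p) ℝ)
    (hP1 : ∀ q : Fin 3 × (I d n p ⊕ J d p),
      (C q.1 ⊗ₖ kkt (K₁ q.2) (Q₁ q.2)) * ((1 : Matrix (Fin 3) (Fin 3) ℝ) ⊗ₖ Matrix.fromRows (What0 r n p) (0 : Matrix (J d p) (CombRows (toSite r) n p) ℝ))
      + ((1 : Matrix (Fin 3) (Fin 3) ℝ) ⊗ₖ kkt (Khat (d := d) n p) (Qhat (d := d) n p))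
          * (C q.1 ⊗ₖ Matrix.fromRows (x₁ q.2) (0 : Matrix (J d p) (CombRows (toSite r) n p) ℝ))
      + oslot (fun q' : Fin 3 × (I d n p ⊕ J d p) => C q'.1 ⊗ₖ Matrix.fromRows (x₁ q'.2) (0 : Matrix (J d p) (CombRows (toSite r) n p) ℝ))
          (fun i => ((1 : Matrix (Fin 3) (Fin 3) ℝ) ⊗ₖ kkt (Khat (d := d) n p) (Qhat (d := d) n p)) i q) = 0)
    (hP2 : ∀ q q'' : Fin 3 × (I d n p ⊕ J d p),
      ((C q.1 * C q''.1) ⊗ₖ kkt (K₂ q.2 q''.2) (Q₂ q.2 q''.2))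
          * ((1 : Matrix (Fin 3) (Fin 3) ℝ) ⊗ₖ Matrix.fromRows (What0 r n p) (0 : Matrix (J d p) (CombRows (toSite r) n p) ℝ))
      + (C q.1 ⊗ₖ kkt (K₁ q.2) (Q₁ q.2)) * (C q''.1 ⊗ₖ Matrix.fromRows (x₁ q''.2) (0 : Matrix (J d p) (CombRows (toSite r) n p) ℝ))
      + (C q''.1 ⊗ₖ kkt (K₁ q''.2) (Q₁ q''.2)) * (C q.1 ⊗ₖ Matrix.fromRows (x₁ q.2) (0 : Matrix (J d p) (CombRows (toSite r) n p) ℝ))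
      + ((1 : Matrix (Fin 3) (Fin 3) ℝ) ⊗ₖ kkt (Khat (d := d) n p) (Qhat (d := d) n p))
          * ((C q.1 * C q''.1) ⊗ₖ Matrix.fromRows (x₂ q.2 q''.2) (0 : Matrix (J d p) (CombRows (toSite r) n p) ℝ))
      + oslot (fun q' : Fin 3 × (I d n p ⊕ J d p) => C q'.1 ⊗ₖ Matrix.fromRows (x₁ q'.2) (0 : Matrix (J d p) (CombRows (toSite r) n p) ℝ))
          (fun i => (C q''.1 ⊗ₖ kkt (K₁ q''.2) (Q₁ q''.2)) i q)
      + oslot (fun q' : Fin 3 × (I d n p ⊕ J d p) => (C q''.1 * C q'.1) ⊗ₖ Matrix.fromRows (x₂ q''.2 q'.2) (0 : Matrix (J d p) (CombRows (toSite r) n p) ℝ))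
          (fun i => ((1 : Matrix (Fin 3) (Fin 3) ℝ) ⊗ₖ kkt (Khat (d := d) n p) (Qhat (d := d) n p)) i q)
      + oslot (fun p' : Fin 3 × (I d n p ⊕ J d p) => (C q.1 * C p'.1) ⊗ₖ Matrix.fromRows (x₂ q.2 p'.2) (0 : Matrix (J d p) (CombRows (toSite r) n p) ℝ))
          (fun i => ((1 : Matrix (Fin 3) (Fin 3) ℝ) ⊗ₖ kkt (Khat (d := d) n p) (Qhat (d := d) n p)) i q'') = 0)
    (bs bt : J d p ⊕ CombRows (toSite r) n p) :
    (∑ k, ∑ l', ((kkt (Khat (d := d) n p) (Matrix.fromRows (Qhat (d := d) n p) (tauT (toSite r) n p)))⁻¹ (Sum.map id Sum.inl k) (Sum.inr bs)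
          * (kkt (Khat (d := d) n p) (Matrix.fromRows (Qhat (d := d) n p) (tauT (toSite r) n p)))⁻¹ (Sum.map id Sum.inl l') (Sum.inr bt)) • K₂ k l')
        * What0 r n p
      + (∑ k, (kkt (Khat (d := d) n p) (Matrix.fromRows (Qhat (d := d) n p) (tauT (toSite r) n p)))⁻¹ (Sum.map id Sum.inl k) (Sum.inr bs) • K₁ k)
        * (∑ k, (kkt (Khat (d := d) n p) (Matrix.fromRows (Qhat (d := d) n p) (tauT (toSite r) n p)))⁻¹ (Sum.map id Sum.inl k) (Sum.inr bt) • x₁ k)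
      + (∑ k, (kkt (Khat (d := d) n p) (Matrix.fromRows (Qhat (d := d) n p) (tauT (toSite r) n p)))⁻¹ (Sum.map id Sum.inl k) (Sum.inr bt) • K₁ k)
        * (∑ k, (kkt (Khat (d := d) n p) (Matrix.fromRows (Qhat (d := d) n p) (tauT (toSite r) n p)))⁻¹ (Sum.map id Sum.inl k) (Sum.inr bs) • x₁ k)
      + Khat (d := d) n p * (∑ k, ∑ l',
          ((kkt (Khat (d := d) n p) (Matrix.fromRows (Qhat (d := d) n p) (tauT (toSite r) n p)))⁻¹ (Sum.map id Sum.inl k) (Sum.inr bs)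
            * (kkt (Khat (d := d) n p) (Matrix.fromRows (Qhat (d := d) n p) (tauT (toSite r) n p)))⁻¹ (Sum.map id Sum.inl l') (Sum.inr bt)) • x₂ k l') = 0
    ∧ (∑ k, ∑ l', ((kkt (Khat (d := d) n p) (Matrix.fromRows (Qhat (d := d) n p) (tauT (toSite r) n p)))⁻¹ (Sum.map id Sum.inl k) (Sum.inr bs)
          * (kkt (Khat (d := d) n p) (Matrix.fromRows (Qhat (d := d) n p) (tauT (toSite r) n p)))⁻¹ (Sum.map id Sum.inl l') (Sum.inr bt)) • Q₂ k l')
        * What0 r n p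
      + (∑ k, (kkt (Khat (d := d) n p) (Matrix.fromRows (Qhat (d := d) n p) (tauT (toSite r) n p)))⁻¹ (Sum.map id Sum.inl k) (Sum.inr bs) • Q₁ k)
        * (∑ k, (kkt (Khat (d := d) n p) (Matrix.fromRows (Qhat (d := d) n p) (tauT (toSite r) n p)))⁻¹ (Sum.map id Sum.inl k) (Sum.inr bt) • x₁ k)
      + (∑ k, (kkt (Khat (d := d) n p) (Matrix.fromRows (Qhat (d := d) n p) (tauT (toSite r) n p)))⁻¹ (Sum.map id Sum.inl k) (Sum.inr bt) • Q₁ k)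
        * (∑ k, (kkt (Khat (d := d) n p) (Matrix.fromRows (Qhat (d := d) n p) (tauT (toSite r) n p)))⁻¹ (Sum.map id Sum.inl k) (Sum.inr bs) • x₁ k)
      + Qhat (d := d) n p * (∑ k, ∑ l',
          ((kkt (Khat (d := d) n p) (Matrix.fromRows (Qhat (d := d) n p) (tauT (toSite r) n p)))⁻¹ (Sum.map id Sum.inl k) (Sum.inr bs)
            * (kkt (Khat (d := d) n p) (Matrix.fromRows (Qhat (d := d) n p) (tauT (toSite r) n p)))⁻¹ (Sum.map id Sum.inl l') (Sum.inr bt)) • x₂ k l') = 0 :=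
  ward₂_even_adE3 C hC _ _ K₁ Q₁ K₂ Q₂ _ x₁ x₂ hP1 hP2 _ _
    (fun q => lifted_source_eq_zero hr p (fun q' => C q.1 * C q'.1) (fun q' => x₂ q.2 q'.2) e₃ bs)
    (fun q => lifted_source_eq_zero hr p (fun p' => C q.1 * C p'.1) (fun p' => x₂ q.2 p'.2) e₃ bt)

/-- [folklore] **THE LETTERS `aₛₜ bₛₜ` FOR FINE-BOND TABLES.**  When all first and second data vanish at the coarse-multiplier indices (the literal differentiates in
the fine-bond variables only), the packed sums run over the fine bonds `k l : I d n p` with the responses `M_T⁻¹ (inl k) (inr b)` of (B4b) ∕ PART 1 — the letters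
`aₛₜ`, `bₛₜ` of the stripped identity VERBATIM with `kₛₜ := Σ_{k,l} rₛ k·rₜ l • K₂ (inl k) (inl l)`, `kₛ := Σ_k rₛ k • K₁ (inl k)`, `wₛₜ := Σ_{k,l} rₛ k·rₜ l • x₂ (inl k) (inl l)`, …. -/
theorem packed_ward₂_field (C : Fin 3 → Matrix (Fin 3) (Fin 3) ℝ) (hC : C 2 = c₃)
    (K₁ : I d n p ⊕ J d p → Matrix (I d n p) (I d n p) ℝ) (Q₁ : I d n p ⊕ J d p → Matrix (J d p) (I d n p) ℝ)
    (K₂ : I d n p ⊕ J d p → I d n p ⊕ J d p → Matrix (I d n p) (I d n p) ℝ) (Q₂ : I d n p ⊕ J d p → I d n p ⊕ J d p → Matrix (J d p) (I d n p) ℝ)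
    (x₁ : I d n p ⊕ J d p → Matrix (I d n p) (CombRows (toSite r) n p) ℝ)
    (x₂ : I d n p ⊕ J d p → I d n p ⊕ J d p → Matrix (I d n p) (CombRows (toSite r) n p) ℝ)
    (hP1 : ∀ q : Fin 3 × (I d n p ⊕ J d p),
      (C q.1 ⊗ₖ kkt (K₁ q.2) (Q₁ q.2)) * ((1 : Matrix (Fin 3) (Fin 3) ℝ) ⊗ₖ Matrix.fromRows (What0 r n p) (0 : Matrix (J d p) (CombRows (toSite r) n p) ℝ))
      + ((1 : Matrix (Fin 3) (Fin 3) ℝ) ⊗ₖ kkt (Khat (d := d) n p) (Qhat (d := d) n p))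
          * (C q.1 ⊗ₖ Matrix.fromRows (x₁ q.2) (0 : Matrix (J d p) (CombRows (toSite r) n p) ℝ))
      + oslot (fun q' : Fin 3 × (I d n p ⊕ J d p) => C q'.1 ⊗ₖ Matrix.fromRows (x₁ q'.2) (0 : Matrix (J d p) (CombRows (toSite r) n p) ℝ))
          (fun i => ((1 : Matrix (Fin 3) (Fin 3) ℝ) ⊗ₖ kkt (Khat (d := d) n p) (Qhat (d := d) n p)) i q) = 0)
    (hP2 : ∀ q q'' : Fin 3 × (I d n p ⊕ J d p),
      ((C q.1 * C q''.1) ⊗ₖ kkt (K₂ q.2 q''.2) (Q₂ q.2 q''.2))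
          * ((1 : Matrix (Fin 3) (Fin 3) ℝ) ⊗ₖ Matrix.fromRows (What0 r n p) (0 : Matrix (J d p) (CombRows (toSite r) n p) ℝ))
      + (C q.1 ⊗ₖ kkt (K₁ q.2) (Q₁ q.2)) * (C q''.1 ⊗ₖ Matrix.fromRows (x₁ q''.2) (0 : Matrix (J d p) (CombRows (toSite r) n p) ℝ))
      + (C q''.1 ⊗ₖ kkt (K₁ q''.2) (Q₁ q''.2)) * (C q.1 ⊗ₖ Matrix.fromRows (x₁ q.2) (0 : Matrix (J d p) (CombRows (toSite r) n p) ℝ))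
      + ((1 : Matrix (Fin 3) (Fin 3) ℝ) ⊗ₖ kkt (Khat (d := d) n p) (Qhat (d := d) n p))
          * ((C q.1 * C q''.1) ⊗ₖ Matrix.fromRows (x₂ q.2 q''.2) (0 : Matrix (J d p) (CombRows (toSite r) n p) ℝ))
      + oslot (fun q' : Fin 3 × (I d n p ⊕ J d p) => C q'.1 ⊗ₖ Matrix.fromRows (x₁ q'.2) (0 : Matrix (J d p) (CombRows (toSite r) n p) ℝ))
          (fun i => (C q''.1 ⊗ₖ kkt (K₁ q''.2) (Q₁ q''.2)) i q)
      + oslot (fun q' : Fin 3 × (I d n p ⊕ J d p) => (C q''.1 * C q'.1) ⊗ₖ Matrix.fromRows (x₂ q''.2 q'.2) (0 : Matrix (J d p) (CombRows (toSite r) n p) ℝ))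
          (fun i => ((1 : Matrix (Fin 3) (Fin 3) ℝ) ⊗ₖ kkt (Khat (d := d) n p) (Qhat (d := d) n p)) i q)
      + oslot (fun p' : Fin 3 × (I d n p ⊕ J d p) => (C q.1 * C p'.1) ⊗ₖ Matrix.fromRows (x₂ q.2 p'.2) (0 : Matrix (J d p) (CombRows (toSite r) n p) ℝ))
          (fun i => ((1 : Matrix (Fin 3) (Fin 3) ℝ) ⊗ₖ kkt (Khat (d := d) n p) (Qhat (d := d) n p)) i q'') = 0)
    (hK₁ : ∀ j, K₁ (Sum.inr j) = 0) (hQ₁ : ∀ j, Q₁ (Sum.inr j) = 0) (hx₁ : ∀ j, x₁ (Sum.inr j) = 0)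
    (hK₂ : ∀ j k, K₂ (Sum.inr j) k = 0) (hK₂' : ∀ k j, K₂ k (Sum.inr j) = 0) (hQ₂ : ∀ j k, Q₂ (Sum.inr j) k = 0) (hQ₂' : ∀ k j, Q₂ k (Sum.inr j) = 0)
    (hx₂ : ∀ j k, x₂ (Sum.inr j) k = 0) (hx₂' : ∀ k j, x₂ k (Sum.inr j) = 0)
    (bs bt : J d p ⊕ CombRows (toSite r) n p) :
    (∑ k : I d n p, ∑ l' : I d n p, ((kkt (Khat (d := d) n p) (Matrix.fromRows (Qhat (d := d) n p) (tauT (toSite r) n p)))⁻¹ (Sum.inl k) (Sum.inr bs)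
          * (kkt (Khat (d := d) n p) (Matrix.fromRows (Qhat (d := d) n p) (tauT (toSite r) n p)))⁻¹ (Sum.inl l') (Sum.inr bt)) • K₂ (Sum.inl k) (Sum.inl l'))
        * What0 r n p
      + (∑ k : I d n p, (kkt (Khat (d := d) n p) (Matrix.fromRows (Qhat (d := d) n p) (tauT (toSite r) n p)))⁻¹ (Sum.inl k) (Sum.inr bs) • K₁ (Sum.inl k))
        * (∑ k : I d n p, (kkt (Khat (d := d) n p) (Matrix.fromRows (Qhat (d := d) n p) (tauT (toSite r) n p)))⁻¹ (Sum.inl k) (Sum.inr bt) • x₁ (Sum.inl k))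
      + (∑ k : I d n p, (kkt (Khat (d := d) n p) (Matrix.fromRows (Qhat (d := d) n p) (tauT (toSite r) n p)))⁻¹ (Sum.inl k) (Sum.inr bt) • K₁ (Sum.inl k))
        * (∑ k : I d n p, (kkt (Khat (d := d) n p) (Matrix.fromRows (Qhat (d := d) n p) (tauT (toSite r) n p)))⁻¹ (Sum.inl k) (Sum.inr bs) • x₁ (Sum.inl k))
      + Khat (d := d) n p * (∑ k : I d n p, ∑ l' : I d n p,
          ((kkt (Khat (d := d) n p) (Matrix.fromRows (Qhat (d := d) n p) (tauT (toSite r) n p)))⁻¹ (Sum.inl k) (Sum.inr bs)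
            * (kkt (Khat (d := d) n p) (Matrix.fromRows (Qhat (d := d) n p) (tauT (toSite r) n p)))⁻¹ (Sum.inl l') (Sum.inr bt)) • x₂ (Sum.inl k) (Sum.inl l')) = 0
    ∧ (∑ k : I d n p, ∑ l' : I d n p, ((kkt (Khat (d := d) n p) (Matrix.fromRows (Qhat (d := d) n p) (tauT (toSite r) n p)))⁻¹ (Sum.inl k) (Sum.inr bs)
          * (kkt (Khat (d := d) n p) (Matrix.fromRows (Qhat (d := d) n p) (tauT (toSite r) n p)))⁻¹ (Sum.inl l') (Sum.inr bt)) • Q₂ (Sum.inl k) (Sum.inl l'))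
        * What0 r n p
      + (∑ k : I d n p, (kkt (Khat (d := d) n p) (Matrix.fromRows (Qhat (d := d) n p) (tauT (toSite r) n p)))⁻¹ (Sum.inl k) (Sum.inr bs) • Q₁ (Sum.inl k))
        * (∑ k : I d n p, (kkt (Khat (d := d) n p) (Matrix.fromRows (Qhat (d := d) n p) (tauT (toSite r) n p)))⁻¹ (Sum.inl k) (Sum.inr bt) • x₁ (Sum.inl k))
      + (∑ k : I d n p, (kkt (Khat (d := d) n p) (Matrix.fromRows (Qhat (d := d) n p) (tauT (toSite r) n p)))⁻¹ (Sum.inl k) (Sum.inr bt) • Q₁ (Sum.inl k))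
        * (∑ k : I d n p, (kkt (Khat (d := d) n p) (Matrix.fromRows (Qhat (d := d) n p) (tauT (toSite r) n p)))⁻¹ (Sum.inl k) (Sum.inr bs) • x₁ (Sum.inl k))
      + Qhat (d := d) n p * (∑ k : I d n p, ∑ l' : I d n p,
          ((kkt (Khat (d := d) n p) (Matrix.fromRows (Qhat (d := d) n p) (tauT (toSite r) n p)))⁻¹ (Sum.inl k) (Sum.inr bs)
            * (kkt (Khat (d := d) n p) (Matrix.fromRows (Qhat (d := d) n p) (tauT (toSite r) n p)))⁻¹ (Sum.inl l') (Sum.inr bt)) • x₂ (Sum.inl k) (Sum.inl l')) = 0 := by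
  have h := packed_ward₂ hr p C hC K₁ Q₁ K₂ Q₂ x₁ x₂ hP1 hP2 bs bt
  simp only [Fintype.sum_sum_type, Sum.map_inl, Sum.map_inr, id, hK₁, hQ₁, hx₁, hK₂, hK₂', hQ₂, hQ₂', hx₂, hx₂', smul_zero,
    Finset.sum_const_zero, add_zero] at h
  exact h

end Torus

end Summit.QuantumFields.BalabanUV.Beta.D1BFx.PackedWardLettersSecond

end
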